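import Literature.MathematicalPhysics.QuantumFieldTheory.Balaban1983to89.B9Thm314QGGQInvFlatTransfer

/-!
# `Balaban1983to89.B9Thm314QGGQInvFlatMultiLevelTorus` — [B9] THEOREM 3.14 (pp. 426–427, (3.154)) AT `U = 1` FOR
`(Q′G′²Q′*)⁻¹` ON THE GENUINE `k`-LEVEL TORUS, FILE 3 OF 3: for two nested families `{Ω_j}`, `{Ω′_j}` on one torus `T_η`
and points `y, y′ ∈ Ω^{(k)}`, `Ω = Ω_k ∩ Ω′_k`,
`|(Q′G′²Q′*)⁻¹[Ω](y, y′) − (Q′G′²Q′*)⁻¹[Ω′](y, y′)| ≤ C·(L^kη)^{−4}(L^kη)^{−d}·e^{−δ·min(d_Ω,d_Ω′)(y,y′)}·e^{−δ·d(y,y′,Ω)}` —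
the characteristic inequality (3.48) = [4] (2.87) «with the additional factor exp(−δ₀d(y, y′, Ω))», `k`-UNIFORM constants,
«M and R sufficiently large» explicit (no existing module is touched; no fact is minted)

FRAMING (verbatim cell line):
statement-level skeleton of published theorems with citation tags; proofs where landed; nothing here is a claim about the Yang–Mills mass gap

Sources under audit (cell pub-balaban / lit-balaban): T. Bałaban, *Propagators for lattice gauge theories in a
background field*, Commun. Math. Phys. **99** (1985) 389–434 [`Balaban1985BackgroundPropagators`, "B9"], pp. 426–427
[PDF 38–39] (Theorem 3.14, (3.154)), p. 398 [PDF 10] (Theorem 3.2, (3.48)) — held text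
`paper:balaban1985-cmp99-background-propagators` p0038/p0039/p0010 and page scans `1985-cmp99-background-propagators-p038`,
`-p010` read this generation; T. Bałaban, *Propagators and renormalization transformations for lattice gauge theories. II*,
Commun. Math. Phys. **96** (1984) 223–250 [`Balaban1984PropagatorsII`, "[4]"], Prop. 2.3 (2.87) p. 238, (2.68)–(2.69)
p. 235, (2.60)–(2.61) p. 234.  Unit `lit-balaban-p21` (Phase-2 proof seat p21 gen 19, HOME `run/shared/lean/pub/lit-balaban/`,
free-target protocol G.5-34(d); B9 fold owner r06, B6 fold owner r03, referee ref-4).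

## WHAT IS PRINTED (quotations AS PRINTED)

B9 p. 426 (scan p038): «… and the points y, y′ in the case of (Q′G′²Q′*)⁻¹, (QGQ*)⁻¹, etc.). We have **Theorem 3.14.**
If we take a pair of operators constructed for the two sequences {Ω_j}, {Ω′_j}, then their difference satisfies all the
inequalities characteristic for operators of the considered type, with the additional factor exp(−δ₀d(y, y′, Ω)),
d(y, y′, Ω) = inf_{y₁∈Ωᶜ∩T^{(k)}} (|y − y₁| + |y₁ − y′|) (3.154) on the right-hand sides.»  B9 p. 398 (scan p010):
«**Theorem 3.2.** Under the assumptions of Theorem 3.1, and with the same constants, the following inequality holds: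
|(Q′(U)G′²(U)Q′*(U))⁻¹(y, y′)| ≤ B₀(L^jη)^{−4}(L^{j′}η)^{−d}e^{−δ₀d(y,y′)}, y, y′ ∈ 𝔅 (y ∈ Λ_j, y′ ∈ Λ_{j′}). (3.48)»
= [4] Proposition 2.3 (2.87) p. 238.

## WHAT THIS FILE CERTIFIES (kernel-checked; lattice units `η = 1`; setting of `B9Thm314GpFlatTorusGeometry`)

* §1 `double_sum_le` — file 2's term estimate summed over `u ∈ 𝔅[D]`, `v ∈ 𝔅[D′]` by (2.61) at `¼δ` in each family
  (`Ineq261With c`): `Σ_{u,v}|A⁻¹(y,u)|·|M(u,v)|·|B⁻¹(v,y′)| ≤ C_G²(C_Δ + 2C_XL⁴)e^{δ}c²·L^{−4k}·e^{−½δd(y,y′,Ω)}`;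
  **`qggqInv_engine`** — the trivial two-term bound (`|A⁻¹(y,y′)| + |B⁻¹(y,y′)| ≤ 2C_GL^{−4k}e^{−δ·min(d_D,d_{D′})(y,y′)}`), the
  transfer-resolvent identity of file 2 with `double_sum_le`, and `min(P²F, Q²F) ≤ PQF`
  (`B9Thm314GpFlatMultiLevelTorus.combined_bound`).
* §2 `abs_mat_GinvT_le`, `abs_mat_X_le` (the torus (2.87) and (2.68) packages read in point masses at a common rate) and
  **`thm314_QGGQinv_flat_multiLevelTorus`**: `∃ δ C M₀ N₀ > 0`, for every `k`, `M_h ≥ 3` with `L·M_h ≥ M₀`, `R ≥ 2L` with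
  `R·L·M_h ≥ N₀ + 1`, `P_μ ≥ 4`, every two families `D, D′`, windowed weights, every two blocks `y, y′` at the top level in
  BOTH families: `|A⁻¹(y, y′) − B⁻¹(y, y′)| ≤ C·L^{−4k}·e^{−δ·min(d_D(y,y′),d_{D′}(y,y′))}·e^{−δ·d(y,y′,Ω)}` in point masses
  and, for the (2.69)-kernels `mat (GinvT · a) y y′ / W(y′)` (the objects of `B6Prop23MultiLevelTorus.prop23_multiLevelTorus`),
  `≤ C·L^{−4k}·((L^k)^{d+1})⁻¹·e^{−δ·min(…)}·e^{−δ·d(y,y′,Ω)}` = (3.48) for the difference with the (3.154) factor.  Inputs BY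
  NAME: `B6Prop23MultiLevelTorus.prop23_multiLevelTorus` ((2.87) and the inverse identities, both families),
  `B6Ineq268MultiLevelTorus.ineq268_multiLevelTorus` ((2.68), both families), file 1
  `B9Thm314GpSqFlatMultiLevelTorus.thm314_X_flat_multiLevelTorus`, `consts_260_261` ((2.60) threshold, (2.61) at `¼δ`).
  Non-vacuity of the hypotheses: `B9Thm314GpFlatMultiLevelTorus.thm314_Gp_flat_nonvacuous` (same binder shape).

## HONEST SCOPE

* `U = 1` only; torus lineage of this seat (`Ω₁ = T_η`, levels `1 … k`, `A = 0`, `m² = 0`, lattice units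
  `(L^jη)^{−4}(L^{j′}η)^{−d} ↦ L^{−4k}·((L^k)^{d+1})⁻¹` at the top level, spatial dimension `d + 1`, `P_μ ≥ 4`); ONLY the
  operator `(Q′G′²Q′*)⁻¹` among those of Theorem 3.14 (the entries for `G′` are `B9Thm314GpFlat*` of gen 18; `G`, `G₁`,
  `𝔊`, `H`, `H₁`, `(QGQ*)⁻¹` are not treated), ONLY common top blocks («the points y, y′ ∈ Ω^{(k)}»), and the characteristic
  factor carries `min(d_D, d_{D′})` (two families, two distances (2.46); print writes one `d(y, y′)`).
* ROUTE (declared; `U = 1` admits it): a transfer-resolvent identity between the two block lattices (file 2) in place of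
  print's walk-expansion cancellation; the inverse is `B6Prop23MultiLevelTorus.GinvT` ([3] Sect. 5 on the whole block
  lattice), whose EXPANSION (2.86) on `T_η` (`B6Expansion286MultiLevelTorus`) is not used here.  Constants: with `C₁, δ₁`
  of the torus (2.87), `C_X, δ₀` of the torus (2.68), `C₂, δ₂` of file 1, `δ = min(½δ₁, ¼δ₀, δ₂)`, `c` the (2.61)-constant of
  the torus at `¼δ`: `C = √(2C₁)·√(C₁²(C₂ + 2C_XL⁴)e^{δ}c²) + 1`, output rate `¼δ`; thresholds `M₀ = max` of the three input
  thresholds, `N₀ = max` of the (2.68), file-1 and `consts_260_261` thresholds — all `k`-uniform, independent of `D, D′`.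
* Nothing is inferred from the manuscript: every step is kernel-checked; the quoted sentences locate the statements.
-/

namespace Literature.MathematicalPhysics.QuantumFieldTheory.Balaban1983to89.B9Thm314QGGQInvFlatMultiLevelTorus

open Finset Matrix
open Literature.MathematicalPhysics.QuantumFieldTheory.Balaban1983to89.B4Reflection242 (boxDom blk)
open Literature.MathematicalPhysics.QuantumFieldTheory.Balaban1983to89.B6MultiLevelBoxOperator
open Literature.MathematicalPhysics.QuantumFieldTheory.Balaban1983to89.B6MultiLevelTorusOperator
open Literature.MathematicalPhysics.QuantumFieldTheory.Balaban1983to89.B6Geom246MultiLevelBox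
open Literature.MathematicalPhysics.QuantumFieldTheory.Balaban1983to89.B6Geom246MultiLevelTorus
open Literature.MathematicalPhysics.QuantumFieldTheory.Balaban1983to89.B8Ineq192MultiLevelTorus (geomTB geomTB_dist
  geomTB_L geomTB_RM geomTB_RM_nonneg levelSepTB lenT_eq symmT symmTB XkT W_eq_lenT_pow lenT_pos)
open Literature.MathematicalPhysics.QuantumFieldTheory.Balaban1983to89.B6Lemma21Repaired (Ineq261With)
open Literature.MathematicalPhysics.QuantumFieldTheory.Balaban1983to89.B6Ineq268 (ratio mx ratio_mul_exp_le LevelSep)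
open Literature.MathematicalPhysics.QuantumFieldTheory.Balaban1983to89.B6Ineq243TwoLevelBox (aNext)
open Literature.MathematicalPhysics.QuantumFieldTheory.Balaban1983to89.B9Thm314GpFlatTorusGeometry
open Literature.MathematicalPhysics.QuantumFieldTheory.Balaban1983to89.B9Thm314GpFlatResolvent (blkOf_eq_iff_blkOf_eq)
open Literature.MathematicalPhysics.QuantumFieldTheory.Balaban1983to89.B9Thm314GpFlatMultiLevelTorus (combined_bound
  consts_260_261)
open Literature.MathematicalPhysics.QuantumFieldTheory.Balaban1983to89.B9Thm314GpSqFlatMultiLevelTorus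
  (thm314_X_flat_multiLevelTorus W_common)
open Literature.MathematicalPhysics.QuantumFieldTheory.Balaban1983to89.B9Thm314QGGQInvFlatTransfer
open Literature.MathematicalPhysics.QuantumFieldTheory.Balaban1983to89.B6Ineq268MultiLevelBox (W W_pos W_eq)
open Literature.MathematicalPhysics.QuantumFieldTheory.Balaban1983to89.B6Ineq268MultiLevelTorus (ineq268_multiLevelTorus)
open Literature.MathematicalPhysics.QuantumFieldTheory.Balaban1983to89.B6Prop23MultiLevelTorus (GinvT prop23_multiLevelTorus)
open Literature.MathematicalPhysics.QuantumFieldTheory.Balaban1983to89.B6Prop23Chain (mat mat_kerOp mat_mul mat_sub)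
open Literature.MathematicalPhysics.QuantumFieldTheory.Balaban1983to89.B6Expansion282 (kerOp)

noncomputable section

variable {d : ℕ}

/-! ## §1 The double sum by (2.61) twice; the engine -/

section Sum

variable {ℓ Mh k R : ℕ} {P : Fin (d + 1) → ℕ} (D D' : TDomains d ℓ Mh k P R) (a : ℕ → ℝ)

/-- **THE DOUBLE SUM**: with (2.61) at `¼δ` on both block lattices (constant `c`),
`Σ_{u,v} |A⁻¹(y,u)|·|M(u,v)|·|B⁻¹(v,y′)| ≤ C_G²(C_Δ + 2C_XL⁴)e^{δ}c²·L^{−4k}·e^{−½δ·d(y,y′,Ω)}`.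
[cite: Balaban1985BackgroundPropagators, Thm 3.14 (3.154) pp.426–427; Balaban1984PropagatorsII, (2.61) p.234] -/
theorem double_sum_le (hMh : 1 ≤ Mh) (hP : ∀ μ, 1 ≤ P μ) (hRM : 1 ≤ R * ((ℓ + 1) * Mh)) {CG CX CΔ δ c : ℝ}
    (hCG : 0 ≤ CG) (hCX : 0 ≤ CX) (hCΔ : 0 ≤ CΔ) (hδ : 0 ≤ δ)
    (hGi : ∀ y u : ↥(bset D.toDomains), |mat (GinvT D a) y u|
      ≤ CG * (((ℓ : ℝ) + 1) ^ (4 * y.1.1))⁻¹ * Real.exp (-(δ * (geomT D).dist y u)))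
    (hGi' : ∀ v y' : ↥(bset D'.toDomains), |mat (GinvT D' a) v y'|
      ≤ CG * (((ℓ : ℝ) + 1) ^ (4 * v.1.1))⁻¹ * Real.exp (-(δ * (geomT D').dist v y')))
    (hX : ∀ u v : ↥(bset D.toDomains), |mat (kerOp (W D.toDomains) (XkT D a)) u v|
      ≤ CX * ((ℓ : ℝ) + 1) ^ (4 * u.1.1) * Real.exp (-(δ * (geomT D).dist u v)))
    (hX' : ∀ u v : ↥(bset D'.toDomains), |mat (kerOp (W D'.toDomains) (XkT D' a)) u v|
      ≤ CX * ((ℓ : ℝ) + 1) ^ (4 * u.1.1) * Real.exp (-(δ * (geomT D').dist u v)))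
    (hΔ : ∀ (u : ↥(bset D.toDomains)) (v : ↥(bset D'.toDomains)) (hu : u.1.1 = k ∧ u.1 ∈ bset D'.toDomains)
      (hv : v.1.1 = k ∧ v.1 ∈ bset D.toDomains),
      |mat (kerOp (W D'.toDomains) (XkT D' a)) ⟨u.1, hu.2⟩ v - mat (kerOp (W D.toDomains) (XkT D a)) u ⟨v.1, hv.2⟩|
        ≤ CΔ * ((ℓ : ℝ) + 1) ^ (4 * k) * Real.exp (-(δ * dOmega D D' u.1.2 v.1.2)))
    (hthr : ((ℓ : ℝ) + 1) ^ 2 ≤ Real.exp (1 / 4 * δ * ((R : ℝ) * (((ℓ : ℝ) + 1) * Mh) - 1)))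
    (h261 : Ineq261With c (geomT D) δ (1 / 4)) (h261' : Ineq261With c (geomT D') δ (1 / 4))
    {y : ↥(bset D.toDomains)} (hy : y.1.1 = k ∧ y.1 ∈ bset D'.toDomains)
    {y' : ↥(bset D'.toDomains)} (hy' : y'.1.1 = k ∧ y'.1 ∈ bset D.toDomains) :
    ∑ u : ↥(bset D.toDomains), ∑ v : ↥(bset D'.toDomains),
        |mat (GinvT D a) y u| * |transKer D D' a u v| * |mat (GinvT D' a) v y'|
      ≤ CG ^ 2 * (CΔ + 2 * CX * ((ℓ : ℝ) + 1) ^ 4) * Real.exp δ * c ^ 2 * (((ℓ : ℝ) + 1) ^ (4 * k))⁻¹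
          * Real.exp (-(δ / 2 * dOmega D D' y.1.2 y'.1.2)) := by
  have hc0 : 0 ≤ c := le_trans (Finset.sum_nonneg fun b _ => (Real.exp_pos _).le) (h261 y)
  have hsu : ∑ u : ↥(bset D.toDomains), Real.exp (-(δ / 4 * (geomT D).dist y u)) ≤ c := by
    have h := h261 y
    calc ∑ u : ↥(bset D.toDomains), Real.exp (-(δ / 4 * (geomT D).dist y u))
        = ∑ u : ↥(bset D.toDomains), Real.exp (-(1 / 4 * δ * (geomT D).dist y u)) :=
          Finset.sum_congr rfl fun u _ => by congr 1; ring
      _ ≤ c := h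
  have hsv : ∑ v : ↥(bset D'.toDomains), Real.exp (-(δ / 4 * (geomT D').dist y' v)) ≤ c := by
    have h := h261' y'
    calc ∑ v : ↥(bset D'.toDomains), Real.exp (-(δ / 4 * (geomT D').dist y' v))
        = ∑ v : ↥(bset D'.toDomains), Real.exp (-(1 / 4 * δ * (geomT D').dist y' v)) :=
          Finset.sum_congr rfl fun v _ => by congr 1; ring
      _ ≤ c := h
  set K : ℝ := CG ^ 2 * (CΔ + 2 * CX * ((ℓ : ℝ) + 1) ^ 4) * (Real.exp δ * (((ℓ : ℝ) + 1) ^ (4 * k))⁻¹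
      * Real.exp (-(δ / 2 * dOmega D D' y.1.2 y'.1.2))) with hK
  have hK0 : 0 ≤ K := by rw [hK]; positivity
  have inner : ∀ u : ↥(bset D.toDomains),
      ∑ v : ↥(bset D'.toDomains), K * (Real.exp (-(δ / 4 * (geomT D).dist y u))
          * Real.exp (-(δ / 4 * (geomT D').dist y' v)))
        = K * Real.exp (-(δ / 4 * (geomT D).dist y u))
          * ∑ v : ↥(bset D'.toDomains), Real.exp (-(δ / 4 * (geomT D').dist y' v)) := by
    intro u
    rw [Finset.mul_sum]
    exact Finset.sum_congr rfl fun v _ => by ring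
  calc ∑ u : ↥(bset D.toDomains), ∑ v : ↥(bset D'.toDomains),
          |mat (GinvT D a) y u| * |transKer D D' a u v| * |mat (GinvT D' a) v y'|
      ≤ ∑ u : ↥(bset D.toDomains), ∑ v : ↥(bset D'.toDomains),
          K * (Real.exp (-(δ / 4 * (geomT D).dist y u)) * Real.exp (-(δ / 4 * (geomT D').dist y' v))) := by
        refine Finset.sum_le_sum fun u _ => Finset.sum_le_sum fun v _ => ?_
        have h := term_le D D' a hMh hP hRM hCG hCX hCΔ hδ hGi hGi' hX hX' hΔ hthr hy hy' u v
        rw [hK]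
        calc _ ≤ _ := h
          _ = _ := by ring
    _ = ∑ u : ↥(bset D.toDomains), K * Real.exp (-(δ / 4 * (geomT D).dist y u))
          * ∑ v : ↥(bset D'.toDomains), Real.exp (-(δ / 4 * (geomT D').dist y' v)) :=
        Finset.sum_congr rfl fun u _ => inner u
    _ ≤ ∑ u : ↥(bset D.toDomains), K * Real.exp (-(δ / 4 * (geomT D).dist y u)) * c :=
        Finset.sum_le_sum fun u _ => mul_le_mul_of_nonneg_left hsv (by positivity)
    _ = K * c * ∑ u : ↥(bset D.toDomains), Real.exp (-(δ / 4 * (geomT D).dist y u)) := by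
        rw [Finset.mul_sum]
        exact Finset.sum_congr rfl fun u _ => by ring
    _ ≤ K * c * c := mul_le_mul_of_nonneg_left hsu (by positivity)
    _ = _ := by rw [hK]; ring

/-- **THE ENGINE FOR `(Q′G′²Q′*)⁻¹`**: under the hypotheses of `double_sum_le` and the two inverse identities
`A⁻¹A = 1`, `BB⁻¹ = 1`, for common top blocks `y`, `y′`:
`|A⁻¹(y, y′) − B⁻¹(y, y′)| ≤ √(2C_G)·√(C_G²(C_Δ + 2C_XL⁴)e^{δ}c²)·L^{−4k}·e^{−½δ·min(d_D(y,y′), d_{D′}(y,y′))}·e^{−¼δ·d(y,y′,Ω)}`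
(trivial two-term bound + `mat_inv_sub_eq`/`double_sum_le` + `min(P²F, Q²F) ≤ PQF`).
[cite: Balaban1985BackgroundPropagators, Thm 3.14 (3.154) pp.426–427, Thm 3.2 (3.48) p.398; Balaban1984PropagatorsII, Prop. 2.3 (2.87) p.238] -/
theorem qggqInv_engine (hMh : 1 ≤ Mh) (hP : ∀ μ, 1 ≤ P μ) (hRM : 1 ≤ R * ((ℓ + 1) * Mh)) {CG CX CΔ δ c : ℝ}
    (hCG : 0 ≤ CG) (hCX : 0 ≤ CX) (hCΔ : 0 ≤ CΔ) (hδ : 0 ≤ δ)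
    (hGi : ∀ y u : ↥(bset D.toDomains), |mat (GinvT D a) y u|
      ≤ CG * (((ℓ : ℝ) + 1) ^ (4 * y.1.1))⁻¹ * Real.exp (-(δ * (geomT D).dist y u)))
    (hGi' : ∀ v y' : ↥(bset D'.toDomains), |mat (GinvT D' a) v y'|
      ≤ CG * (((ℓ : ℝ) + 1) ^ (4 * v.1.1))⁻¹ * Real.exp (-(δ * (geomT D').dist v y')))
    (hX : ∀ u v : ↥(bset D.toDomains), |mat (kerOp (W D.toDomains) (XkT D a)) u v|
      ≤ CX * ((ℓ : ℝ) + 1) ^ (4 * u.1.1) * Real.exp (-(δ * (geomT D).dist u v)))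
    (hX' : ∀ u v : ↥(bset D'.toDomains), |mat (kerOp (W D'.toDomains) (XkT D' a)) u v|
      ≤ CX * ((ℓ : ℝ) + 1) ^ (4 * u.1.1) * Real.exp (-(δ * (geomT D').dist u v)))
    (hΔ : ∀ (u : ↥(bset D.toDomains)) (v : ↥(bset D'.toDomains)) (hu : u.1.1 = k ∧ u.1 ∈ bset D'.toDomains)
      (hv : v.1.1 = k ∧ v.1 ∈ bset D.toDomains),
      |mat (kerOp (W D'.toDomains) (XkT D' a)) ⟨u.1, hu.2⟩ v - mat (kerOp (W D.toDomains) (XkT D a)) u ⟨v.1, hv.2⟩|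
        ≤ CΔ * ((ℓ : ℝ) + 1) ^ (4 * k) * Real.exp (-(δ * dOmega D D' u.1.2 v.1.2)))
    (hthr : ((ℓ : ℝ) + 1) ^ 2 ≤ Real.exp (1 / 4 * δ * ((R : ℝ) * (((ℓ : ℝ) + 1) * Mh) - 1)))
    (h261 : Ineq261With c (geomT D) δ (1 / 4)) (h261' : Ineq261With c (geomT D') δ (1 / 4))
    (h1 : GinvT D a * kerOp (W D.toDomains) (XkT D a) = 1)
    (h2 : kerOp (W D'.toDomains) (XkT D' a) * GinvT D' a = 1)
    {y : ↥(bset D.toDomains)} (hy : y.1.1 = k ∧ y.1 ∈ bset D'.toDomains)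
    {y' : ↥(bset D'.toDomains)} (hy' : y'.1.1 = k ∧ y'.1 ∈ bset D.toDomains) :
    |mat (GinvT D a) y ⟨y'.1, hy'.2⟩ - mat (GinvT D' a) ⟨y.1, hy.2⟩ y'|
      ≤ Real.sqrt (2 * CG) * Real.sqrt (CG ^ 2 * (CΔ + 2 * CX * ((ℓ : ℝ) + 1) ^ 4) * Real.exp δ * c ^ 2)
          * (((ℓ : ℝ) + 1) ^ (4 * k))⁻¹
        * Real.exp (-(1 / 2 * δ * min ((geomT D).dist y ⟨y'.1, hy'.2⟩) ((geomT D').dist ⟨y.1, hy.2⟩ y')))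
        * Real.exp (-(1 / 4 * δ * dOmega D D' y.1.2 y'.1.2)) := by
  have hd0 : ∀ s t : ↥(bset D.toDomains), 0 ≤ (geomT D).dist s t := (triangle_refl_nonneg_T D hMh hP).2.2
  have hd0' : ∀ s t : ↥(bset D'.toDomains), 0 ≤ (geomT D').dist s t := (triangle_refl_nonneg_T D' hMh hP).2.2
  have hc0 : 0 ≤ c := le_trans (Finset.sum_nonneg fun b _ => (Real.exp_pos _).le) (h261 y)
  have hF : (0 : ℝ) ≤ (((ℓ : ℝ) + 1) ^ (4 * k))⁻¹ := by positivity
  -- (i) the trivial bound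
  have hGy := hGi y ⟨y'.1, hy'.2⟩
  rw [hy.1] at hGy
  have key : ∀ w : ↥(bset D'.toDomains), w.1.1 = k →
      |mat (GinvT D' a) w y'| ≤ CG * (((ℓ : ℝ) + 1) ^ (4 * k))⁻¹ * Real.exp (-(δ * (geomT D').dist w y')) := by
    intro w hw; have h := hGi' w y'; rw [hw] at h; exact h
  have hGy' := key ⟨y.1, hy.2⟩ hy.1
  set m : ℝ := min ((geomT D).dist y ⟨y'.1, hy'.2⟩) ((geomT D').dist ⟨y.1, hy.2⟩ y') with hm
  have hm1 : Real.exp (-(δ * (geomT D).dist y ⟨y'.1, hy'.2⟩)) ≤ Real.exp (-(δ * m)) :=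
    Real.exp_le_exp.2 (by nlinarith [min_le_left ((geomT D).dist y ⟨y'.1, hy'.2⟩) ((geomT D').dist ⟨y.1, hy.2⟩ y')])
  have hm2 : Real.exp (-(δ * (geomT D').dist ⟨y.1, hy.2⟩ y')) ≤ Real.exp (-(δ * m)) :=
    Real.exp_le_exp.2 (by nlinarith [min_le_right ((geomT D).dist y ⟨y'.1, hy'.2⟩) ((geomT D').dist ⟨y.1, hy.2⟩ y')])
  have htriv : |mat (GinvT D a) y ⟨y'.1, hy'.2⟩ - mat (GinvT D' a) ⟨y.1, hy.2⟩ y'|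
      ≤ 2 * CG * (((ℓ : ℝ) + 1) ^ (4 * k))⁻¹ * Real.exp (-(δ * m)) := by
    calc _ ≤ |mat (GinvT D a) y ⟨y'.1, hy'.2⟩| + |mat (GinvT D' a) ⟨y.1, hy.2⟩ y'| := abs_sub _ _
      _ ≤ CG * (((ℓ : ℝ) + 1) ^ (4 * k))⁻¹ * Real.exp (-(δ * m))
          + CG * (((ℓ : ℝ) + 1) ^ (4 * k))⁻¹ * Real.exp (-(δ * m)) :=
          add_le_add (hGy.trans (mul_le_mul_of_nonneg_left hm1 (by positivity)))
            (hGy'.trans (mul_le_mul_of_nonneg_left hm2 (by positivity)))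
      _ = _ := by ring
  -- (ii) the resolvent bound
  have hres : |mat (GinvT D a) y ⟨y'.1, hy'.2⟩ - mat (GinvT D' a) ⟨y.1, hy.2⟩ y'|
      ≤ CG ^ 2 * (CΔ + 2 * CX * ((ℓ : ℝ) + 1) ^ 4) * Real.exp δ * c ^ 2 * (((ℓ : ℝ) + 1) ^ (4 * k))⁻¹
          * Real.exp (-(1 / 2 * δ * dOmega D D' y.1.2 y'.1.2)) := by
    rw [mat_inv_sub_eq D D' a h1 h2 y hy y' hy']
    refine (Finset.abs_sum_le_sum_abs _ _).trans ?_
    refine (Finset.sum_le_sum fun u _ => Finset.abs_sum_le_sum_abs _ _).trans ?_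
    have e : ∀ u v, |mat (GinvT D a) y u * transKer D D' a u v * mat (GinvT D' a) v y'|
        = |mat (GinvT D a) y u| * |transKer D D' a u v| * |mat (GinvT D' a) v y'| := fun u v => by
      rw [abs_mul, abs_mul]
    simp_rw [e]
    have h := double_sum_le D D' a hMh hP hRM hCG hCX hCΔ hδ hGi hGi' hX hX' hΔ hthr h261 h261' hy hy'
    calc _ ≤ _ := h
      _ = _ := by ring_nf
  -- (iii) combine
  have h1' : |mat (GinvT D a) y ⟨y'.1, hy'.2⟩ - mat (GinvT D' a) ⟨y.1, hy.2⟩ y'|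
      ≤ (2 * CG) * (((ℓ : ℝ) + 1) ^ (4 * k))⁻¹ * Real.exp (-(δ * m)) := by
    calc _ ≤ _ := htriv
      _ = _ := by ring
  have h2' : |mat (GinvT D a) y ⟨y'.1, hy'.2⟩ - mat (GinvT D' a) ⟨y.1, hy.2⟩ y'|
      ≤ (CG ^ 2 * (CΔ + 2 * CX * ((ℓ : ℝ) + 1) ^ 4) * Real.exp δ * c ^ 2) * (((ℓ : ℝ) + 1) ^ (4 * k))⁻¹
        * Real.exp (-(1 / 2 * δ * dOmega D D' y.1.2 y'.1.2)) := by
    calc _ ≤ _ := hres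
      _ = _ := by ring
  have hcomb := combined_bound (by positivity) (by positivity) hF h1' h2'
  calc _ ≤ _ := hcomb
    _ = _ := by rw [hm]

end Sum

/-! ## §2 Theorem 3.14 at `U = 1` for `(Q′G′²Q′*)⁻¹` (characteristic inequality (3.48) = [4] (2.87)), thresholds explicit -/

section Main

variable {ℓ Mh k R : ℕ} {P : Fin (d + 1) → ℕ}

/-- reading the (2.87) package in point masses: `|A⁻¹(y, u)| ≤ C·L^{−4j(y)}·e^{−δd(y,u)}` for `δ ≤ ½δ₁`
(`W(u) = (L^{j(u)})^{d+1}` cancels the factor `(L^{j′}η)^{−d}`). [cite: Balaban1984PropagatorsII, Prop. 2.3 (2.87) p.238, (2.69) p.235] -/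
theorem abs_mat_GinvT_le (D₀ : TDomains d ℓ Mh k P R) (hMh : 1 ≤ Mh) (hP : ∀ μ, 1 ≤ P μ) (a : ℕ → ℝ) {C δ₁ δ : ℝ}
    (hC : 0 ≤ C) (hδ₁ : δ ≤ δ₁ / 2)
    (h87 : ∀ y y' : ↥(bset D₀.toDomains), |mat (GinvT D₀ a) y y' / W D₀.toDomains y'| ≤
      C * (geomT D₀).len y ^ (-(4 : ℝ)) * (geomT D₀).len y' ^ (-((d + 1 : ℕ) : ℝ)) *
        Real.exp (-(δ₁ / 2 * (geomT D₀).dist y y')))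
    (y u : ↥(bset D₀.toDomains)) :
    |mat (GinvT D₀ a) y u| ≤ C * (((ℓ : ℝ) + 1) ^ (4 * y.1.1))⁻¹ * Real.exp (-(δ * (geomT D₀).dist y u)) := by
  have h := h87 y u
  have hW := W_pos D₀.toDomains u
  have hly := lenT_pos D₀ y
  have hlu := lenT_pos D₀ u
  rw [abs_div, abs_of_pos hW, div_le_iff₀ hW, Real.rpow_neg hly.le, Real.rpow_neg hlu.le,
    show (4 : ℝ) = ((4 : ℕ) : ℝ) by norm_num, Real.rpow_natCast, Real.rpow_natCast, ← W_eq_lenT_pow] at h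
  have hd := (triangle_refl_nonneg_T D₀ hMh hP).2.2 y u
  have hlen4 : (geomT D₀).len y ^ 4 = ((ℓ : ℝ) + 1) ^ (4 * y.1.1) := by rw [lenT_eq, ← pow_mul, mul_comm]
  calc |mat (GinvT D₀ a) y u| ≤ C * ((geomT D₀).len y ^ 4)⁻¹ * (W D₀.toDomains u)⁻¹
          * Real.exp (-(δ₁ / 2 * (geomT D₀).dist y u)) * W D₀.toDomains u := h
    _ = C * ((geomT D₀).len y ^ 4)⁻¹ * Real.exp (-(δ₁ / 2 * (geomT D₀).dist y u)) := by field_simp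
    _ ≤ C * ((geomT D₀).len y ^ 4)⁻¹ * Real.exp (-(δ * (geomT D₀).dist y u)) :=
        mul_le_mul_of_nonneg_left (Real.exp_le_exp.2 (by nlinarith)) (by positivity)
    _ = _ := by rw [hlen4]

/-- reading the (2.68) package in point masses: `|A(u, v)| ≤ C·L^{4j(u)}·e^{−δd(u,v)}` for `δ ≤ ¼δ₀`.
[cite: Balaban1984PropagatorsII, (2.68)–(2.69) p.235] -/
theorem abs_mat_X_le (D₀ : TDomains d ℓ Mh k P R) (hMh : 1 ≤ Mh) (hP : ∀ μ, 1 ≤ P μ) (a : ℕ → ℝ) {C δ₀ δ : ℝ}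
    (hC : 0 ≤ C) (hδ₀ : δ ≤ 1 / 2 * (δ₀ / 2))
    (h68 : ∀ y y' : ↥(bset D₀.toDomains), |(geomT D₀).len y' ^ (d + 1) * XkT D₀ a y y'| ≤
      C * (geomT D₀).len y ^ 4 * Real.exp (-(1 / 2 * (δ₀ / 2) * (geomT D₀).dist y y')))
    (u v : ↥(bset D₀.toDomains)) :
    |mat (kerOp (W D₀.toDomains) (XkT D₀ a)) u v| ≤ C * ((ℓ : ℝ) + 1) ^ (4 * u.1.1) * Real.exp (-(δ * (geomT D₀).dist u v)) := by
  have h := h68 u v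
  have hd := (triangle_refl_nonneg_T D₀ hMh hP).2.2 u v
  rw [mat_kerOp, W_eq_lenT_pow]
  have hlen4 : (geomT D₀).len u ^ 4 = ((ℓ : ℝ) + 1) ^ (4 * u.1.1) := by rw [lenT_eq, ← pow_mul, mul_comm]
  calc _ ≤ _ := h
    _ ≤ C * (geomT D₀).len u ^ 4 * Real.exp (-(δ * (geomT D₀).dist u v)) :=
        mul_le_mul_of_nonneg_left (Real.exp_le_exp.2 (by nlinarith)) (by positivity)
    _ = _ := by rw [hlen4]

/-- **[B9] THEOREM 3.14 AT `U = 1` FOR `(Q′G′²Q′*)⁻¹` ON THE GENUINE `k`-LEVEL TORUS — THE CHARACTERISTIC INEQUALITY (3.48)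
= [4] (2.87) WITH THE FACTOR (3.154).**  There are `δ, C, M₀ > 0` and `N₀ ≥ 1` (functions of `d`, `L` and the weight window,
NOT of the torus, of `k` or of the families) such that for every `k`, `M_h ≥ 3` with `L·M_h ≥ M₀` («M sufficiently large»),
`R ≥ 2L` with `R·L·M_h ≥ N₀ + 1` («R sufficiently large»), `P_μ ≥ 4`, EVERY TWO nested families `D, D′` of the torus
(2.1)–(2.2) (levels `1 … k`, `Ω₁ = Ω′₁ = T_η`), windowed weights, and every two points `y, y′ ∈ Ω^{(k)}`, `Ω = Ω_k ∩ Ω′_k`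
(blocks at the top level in BOTH families — «the points y, y′ in the case of (Q′G′²Q′*)⁻¹»), with
`(Q′G′²Q′*)⁻¹[D] = GinvT D a` the inverse of `B6Prop23MultiLevelTorus` (unique two-sided inverse of `kerOp W (XkT D a)`) and
its (2.69)-kernel `(Q′G′²Q′*)⁻¹[D](y, y′) = mat (GinvT D a) y y′ / W(y′)`:
`|(Q′G′²Q′*)⁻¹[D](y, y′) − (Q′G′²Q′*)⁻¹[D′](y, y′)| ≤ C·(L^k)^{−4}·((L^k)^{d+1})⁻¹·e^{−δ·min(d_D(y,y′), d_{D′}(y,y′))}·e^{−δ·d(y,y′,Ω)}`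
(print: «|(Q′(U)G′²(U)Q′*(U))⁻¹(y, y′)| ≤ B₀(L^jη)^{−4}(L^{j′}η)^{−d}e^{−δ₀d(y,y′)}» (3.48) «with the additional factor
exp(−δ₀d(y, y′, Ω))»), together with the same bound in point masses (`mat`, without the `W(y′)⁻¹ = ((L^k)^{d+1})⁻¹`).
Route (declared; `U = 1` admits it): the transfer-resolvent identity of §2 + §3 + the trivial bound + `min(P²F,Q²F) ≤ PQF`;
inputs BY NAME: the torus (2.87) `B6Prop23MultiLevelTorus.prop23_multiLevelTorus` and (2.68)
`B6Ineq268MultiLevelTorus.ineq268_multiLevelTorus` for both families, file 1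
`B9Thm314GpSqFlatMultiLevelTorus.thm314_X_flat_multiLevelTorus`, (2.60)/(2.61) on the torus (`consts_260_261`).  The
hypotheses are met (`B9Thm314GpFlatMultiLevelTorus.thm314_Gp_flat_nonvacuous`).
[cite: Balaban1985BackgroundPropagators, Thm 3.14 (3.154) pp.426–427, Thm 3.2 (3.48) p.398; Balaban1984PropagatorsII, Prop. 2.3 (2.87) p.238] -/
theorem thm314_QGGQinv_flat_multiLevelTorus (d ℓ : ℕ) (hℓ : 1 ≤ ℓ) (aminus aplus a2minus a2plus : ℝ)
    (ha : 0 < aminus) (ha2 : 0 < a2minus) :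
    ∃ δ C M₀ : ℝ, ∃ N₀ : ℕ, 0 < δ ∧ 0 < C ∧ 0 < M₀ ∧ 0 < N₀ ∧
      ∀ (k Mh R : ℕ), 3 ≤ Mh → M₀ ≤ ((ℓ : ℝ) + 1) * Mh → 2 * (ℓ + 1) ≤ R → N₀ + 1 ≤ R * ((ℓ + 1) * Mh) →
      ∀ (P : Fin (d + 1) → ℕ) (hP : ∀ μ, 1 ≤ P μ) (hP4 : ∀ μ, 4 ≤ P μ) (D D' : TDomains d ℓ Mh k P R)
        (a c : ℕ → ℝ), (∀ i, 1 ≤ i → aminus ≤ a i ∧ a i ≤ aplus) → (∀ i, 1 ≤ i → a2minus ≤ c i ∧ c i ≤ a2plus) →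
        (∀ i, 1 ≤ i → a (i + 1) = aNext ℓ (a i) (c i)) →
      ∀ (p q : ℕ × (Fin (d + 1) → ℤ)) (hpD : p ∈ bset D.toDomains) (hpD' : p ∈ bset D'.toDomains)
        (hqD : q ∈ bset D.toDomains) (hqD' : q ∈ bset D'.toDomains), p.1 = k → q.1 = k →
        |mat (GinvT D a) ⟨p, hpD⟩ ⟨q, hqD⟩ - mat (GinvT D' a) ⟨p, hpD'⟩ ⟨q, hqD'⟩|
            ≤ C * (((ℓ : ℝ) + 1) ^ (4 * k))⁻¹
              * Real.exp (-(δ * min ((geomT D).dist ⟨p, hpD⟩ ⟨q, hqD⟩) ((geomT D').dist ⟨p, hpD'⟩ ⟨q, hqD'⟩)))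
              * Real.exp (-(δ * dOmega D D' p.2 q.2)) ∧
        |mat (GinvT D a) ⟨p, hpD⟩ ⟨q, hqD⟩ / W D.toDomains ⟨q, hqD⟩
            - mat (GinvT D' a) ⟨p, hpD'⟩ ⟨q, hqD'⟩ / W D'.toDomains ⟨q, hqD'⟩|
            ≤ C * (((ℓ : ℝ) + 1) ^ (4 * k))⁻¹ * ((((ℓ : ℝ) + 1) ^ k) ^ (d + 1))⁻¹
              * Real.exp (-(δ * min ((geomT D).dist ⟨p, hpD⟩ ⟨q, hqD⟩) ((geomT D').dist ⟨p, hpD'⟩ ⟨q, hqD'⟩)))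
              * Real.exp (-(δ * dOmega D D' p.2 q.2)) := by
  obtain ⟨δ₁, C₁, M₁, hδ₁, hC₁, hM₁, h87⟩ := prop23_multiLevelTorus d ℓ hℓ aminus aplus a2minus a2plus ha ha2
  obtain ⟨δ₀, CX, M₀, N₀, hδ₀, hCX, hM₀, hN₀, h68⟩ := ineq268_multiLevelTorus d ℓ hℓ aminus aplus a2minus a2plus ha ha2
  obtain ⟨δ₂, C₂, M₂, N₂, hδ₂, hC₂, hM₂, hN₂, hΔ⟩ := thm314_X_flat_multiLevelTorus d ℓ hℓ aminus aplus a2minus a2plus ha ha2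
  have hL0 : (0 : ℝ) < (ℓ : ℝ) + 1 := by positivity
  -- the common rate
  obtain ⟨δ, hδ⟩ : ∃ δ : ℝ, δ = min (δ₁ / 2) (min (1 / 2 * (δ₀ / 2)) δ₂) := ⟨_, rfl⟩
  have hδpos : 0 < δ := by rw [hδ]; exact lt_min (by positivity) (lt_min (by positivity) hδ₂)
  have hδa : δ ≤ δ₁ / 2 := by rw [hδ]; exact min_le_left _ _
  have hδb : δ ≤ 1 / 2 * (δ₀ / 2) := by rw [hδ]; exact (min_le_right _ _).trans (min_le_left _ _)
  have hδc : δ ≤ δ₂ := by rw [hδ]; exact (min_le_right _ _).trans (min_le_right _ _)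
  obtain ⟨N₃, cK, hN₃, hcK0, hcon⟩ := consts_260_261 d ℓ hδpos
  obtain ⟨K, hK⟩ : ∃ K : ℝ, K = C₁ ^ 2 * (C₂ + 2 * CX * ((ℓ : ℝ) + 1) ^ 4) * Real.exp δ * cK ^ 2 := ⟨_, rfl⟩
  have hK0 : 0 ≤ K := by rw [hK]; positivity
  refine ⟨1 / 4 * δ, Real.sqrt (2 * C₁) * Real.sqrt K + 1, max M₁ (max M₀ M₂), max N₀ (max N₂ N₃), by positivity,
    by positivity, lt_of_lt_of_le hM₁ (le_max_left _ _), lt_of_lt_of_le hN₀ (le_max_left _ _), ?_⟩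
  intro k Mh R hMh hM hR hRM P hP hP4 D D' a c haw hcw hac p q hpD hpD' hqD hqD' hp hq
  have hMh1 : 1 ≤ Mh := le_trans (by norm_num) hMh
  have hM1' : M₁ ≤ ((ℓ : ℝ) + 1) * Mh := le_trans (le_max_left _ _) hM
  have hM0' : M₀ ≤ ((ℓ : ℝ) + 1) * Mh := le_trans ((le_max_left _ _).trans (le_max_right _ _)) hM
  have hM2' : M₂ ≤ ((ℓ : ℝ) + 1) * Mh := le_trans ((le_max_right _ _).trans (le_max_right _ _)) hM
  have hRM0 : N₀ + 1 ≤ R * ((ℓ + 1) * Mh) := le_trans (Nat.add_le_add_right (le_max_left _ _) 1) hRM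
  have hRM2 : N₂ + 1 ≤ R * ((ℓ + 1) * Mh) :=
    le_trans (Nat.add_le_add_right ((le_max_left N₂ N₃).trans (le_max_right N₀ _)) 1) hRM
  have hRM3 : N₃ + 1 ≤ R * ((ℓ + 1) * Mh) :=
    le_trans (Nat.add_le_add_right ((le_max_right N₂ N₃).trans (le_max_right N₀ _)) 1) hRM
  have hRMone : 1 ≤ R * ((ℓ + 1) * Mh) := le_trans (by omega) hRM3
  obtain ⟨hthr, h261f⟩ := hcon k Mh R P hMh1 hP hRM3
  -- the packages for the two families
  obtain ⟨h1D, -, -, h87D⟩ := h87 k Mh R hM1' hR P hP hP4 D a c haw hcw hac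
  obtain ⟨-, h2D', -, h87D'⟩ := h87 k Mh R hM1' hR P hP hP4 D' a c haw hcw hac
  have h68D := fun y y' => (h68 k Mh R hMh hM0' hR hRM0 P hP hP4 D a c haw hcw hac y y').2
  have h68D' := fun y y' => (h68 k Mh R hMh hM0' hR hRM0 P hP hP4 D' a c haw hcw hac y y').2
  have hΔ' := hΔ k Mh R hMh hM2' hR hRM2 P hP hP4 D D' a c haw hcw hac
  -- the hypotheses of the engine at the common rate
  have hGi := abs_mat_GinvT_le D hMh1 hP a hC₁.le hδa h87D
  have hGi' := abs_mat_GinvT_le D' hMh1 hP a hC₁.le hδa h87D'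
  have hX := abs_mat_X_le D hMh1 hP a hCX.le hδb h68D
  have hX' := abs_mat_X_le D' hMh1 hP a hCX.le hδb h68D'
  have hΔe : ∀ (u : ↥(bset D.toDomains)) (v : ↥(bset D'.toDomains)) (hu : u.1.1 = k ∧ u.1 ∈ bset D'.toDomains)
      (hv : v.1.1 = k ∧ v.1 ∈ bset D.toDomains),
      |mat (kerOp (W D'.toDomains) (XkT D' a)) ⟨u.1, hu.2⟩ v - mat (kerOp (W D.toDomains) (XkT D a)) u ⟨v.1, hv.2⟩|
        ≤ C₂ * ((ℓ : ℝ) + 1) ^ (4 * k) * Real.exp (-(δ * dOmega D D' u.1.2 v.1.2)) := by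
    intro u v hu hv
    have h := (hΔ' u.1 v.1 u.2 hu.2 hv.2 v.2 hu.1 hv.1).1
    rw [Subtype.coe_eta, Subtype.coe_eta] at h
    rw [mat_kerOp, mat_kerOp, abs_sub_comm]
    refine h.trans ?_
    have hm0 : 0 ≤ min ((geomT D).dist u ⟨v.1, hv.2⟩) ((geomT D').dist ⟨u.1, hu.2⟩ v) :=
      le_min ((triangle_refl_nonneg_T D hMh1 hP).2.2 _ _) ((triangle_refl_nonneg_T D' hMh1 hP).2.2 _ _)
    have hΩ0 := dOmega_nonneg D D' u.1.2 v.1.2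
    have e1 : Real.exp (-(δ₂ * min ((geomT D).dist u ⟨v.1, hv.2⟩) ((geomT D').dist ⟨u.1, hu.2⟩ v))) ≤ 1 :=
      Real.exp_le_one_iff.2 (by nlinarith)
    have e2 : Real.exp (-(δ₂ * dOmega D D' u.1.2 v.1.2)) ≤ Real.exp (-(δ * dOmega D D' u.1.2 v.1.2)) :=
      Real.exp_le_exp.2 (by nlinarith)
    calc C₂ * ((ℓ : ℝ) + 1) ^ (4 * k)
          * Real.exp (-(δ₂ * min ((geomT D).dist u ⟨v.1, hv.2⟩) ((geomT D').dist ⟨u.1, hu.2⟩ v)))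
          * Real.exp (-(δ₂ * dOmega D D' u.1.2 v.1.2))
        ≤ C₂ * ((ℓ : ℝ) + 1) ^ (4 * k) * 1 * Real.exp (-(δ * dOmega D D' u.1.2 v.1.2)) :=
          mul_le_mul (mul_le_mul_of_nonneg_left e1 (by positivity)) e2 (Real.exp_pos _).le (by positivity)
      _ = _ := by rw [mul_one]
  -- the engine
  have hmain := qggqInv_engine D D' a hMh1 hP hRMone hC₁.le hCX.le hC₂.le hδpos.le hGi hGi' hX hX' hΔe hthr
    (h261f D) (h261f D') h1D h2D' (y := ⟨p, hpD⟩) ⟨hp, hpD'⟩ (y' := ⟨q, hqD'⟩) ⟨hq, hqD⟩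
  rw [← hK] at hmain
  -- constants and rates
  have hm0 : 0 ≤ min ((geomT D).dist ⟨p, hpD⟩ ⟨q, hqD⟩) ((geomT D').dist ⟨p, hpD'⟩ ⟨q, hqD'⟩) :=
    le_min ((triangle_refl_nonneg_T D hMh1 hP).2.2 _ _) ((triangle_refl_nonneg_T D' hMh1 hP).2.2 _ _)
  have hw1 : Real.exp (-(1 / 2 * δ * min ((geomT D).dist ⟨p, hpD⟩ ⟨q, hqD⟩) ((geomT D').dist ⟨p, hpD'⟩ ⟨q, hqD'⟩)))
      ≤ Real.exp (-(1 / 4 * δ * min ((geomT D).dist ⟨p, hpD⟩ ⟨q, hqD⟩) ((geomT D').dist ⟨p, hpD'⟩ ⟨q, hqD'⟩))) :=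
    Real.exp_le_exp.2 (by nlinarith)
  have hsq : Real.sqrt (2 * C₁) * Real.sqrt K ≤ Real.sqrt (2 * C₁) * Real.sqrt K + 1 := by linarith
  have hfirst : |mat (GinvT D a) ⟨p, hpD⟩ ⟨q, hqD⟩ - mat (GinvT D' a) ⟨p, hpD'⟩ ⟨q, hqD'⟩|
      ≤ (Real.sqrt (2 * C₁) * Real.sqrt K + 1) * (((ℓ : ℝ) + 1) ^ (4 * k))⁻¹
          * Real.exp (-(1 / 4 * δ * min ((geomT D).dist ⟨p, hpD⟩ ⟨q, hqD⟩) ((geomT D').dist ⟨p, hpD'⟩ ⟨q, hqD'⟩)))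
          * Real.exp (-(1 / 4 * δ * dOmega D D' p.2 q.2)) := by
    calc _ ≤ _ := hmain
      _ ≤ _ := by
          refine mul_le_mul_of_nonneg_right ?_ (Real.exp_pos _).le
          exact mul_le_mul (mul_le_mul_of_nonneg_right hsq (by positivity)) hw1 (Real.exp_pos _).le (by positivity)
  refine ⟨hfirst, ?_⟩
  have hWq : W D.toDomains ⟨q, hqD⟩ = (((ℓ : ℝ) + 1) ^ k) ^ (d + 1) := by rw [W_eq]; simp only [hq]
  have hWq' : W D'.toDomains ⟨q, hqD'⟩ = (((ℓ : ℝ) + 1) ^ k) ^ (d + 1) := by rw [W_eq]; simp only [hq]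
  have hWpos : (0 : ℝ) < (((ℓ : ℝ) + 1) ^ k) ^ (d + 1) := by positivity
  rw [hWq, hWq', ← sub_div, abs_div, abs_of_pos hWpos, div_le_iff₀ hWpos]
  calc _ ≤ _ := hfirst
    _ = _ := by field_simp

end Main

end

end Literature.MathematicalPhysics.QuantumFieldTheory.Balaban1983to89.B9Thm314QGGQInvFlatMultiLevelTorus
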